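import Summits.NavierStokesRegularity.TurbBounds.Certs.N1prime.EvalData1
import Summits.NavierStokesRegularity.TurbBounds.Certs.N1prime.EvalData2
import Summits.NavierStokesRegularity.TurbBounds.Certs.N1prime.EvalData3
import Summits.NavierStokesRegularity.TurbBounds.Certs.N1prime.EvalData4
import Summits.NavierStokesRegularity.TurbBounds.Certs.N1prime.EvalData5
import Summits.NavierStokesRegularity.TurbBounds.Certs.N1prime.EvalData6
import Summits.NavierStokesRegularity.TurbBounds.Certs.N1prime.EvalData7
import Summits.NavierStokesRegularity.TurbBounds.EvalRows
import Mathlib.Data.Real.Basic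
import Mathlib.Algebra.Order.Star.Real
import Literature.Computation.Certificates.Blocks
import HarnessLib

/-!
# Row N1prime evaluator — part `EvalRule`: the mode rule `Mel`, its pencil forms, the REAL pencil `MelR` (real data AND real Young weight, lemma R-I′) and the transfer of block PSD facts to it
(cell `pub-turb` / `turb-bounds`, v2 item RB-N1′-in-Lean per HOME/pub-turb-cert/RB-LEAN-V2-DESIGN.md §1; producer of THIS FILE pub-turb-cert = prover-pub-turb-cert-g7-0 (t12_evaluator_rb.py, the P > 0 extension of pub-turb-sos's t12_evaluator.py); row and source container by pub-turb-cert: `HOME/pub-turb-cert/certs/N1prime-canary-ra1e4-allk/rbcert.json`, rbcert/0, sha256 `5daad8d71401bf8a…`; CERTIFIED.md row RB-N1′: Ra = 10000, ALL horizontal periods / lattices, `Nu ≤ 871753553815459157/273640575184404480` (outward decimal 3.1857613).)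

HONEST FRAMING: rigorous bounds for the stated PDE and boundary conditions; no claim about physical turbulence beyond the bound.
FILE LAYOUT of the row-N1prime evaluator (one namespace `Summit.NavierStokesRegularity.TurbBounds.Certs.N1prime.Evaluator` reopened across the files, every file ≤ 400 lines; the layout of the tree's `Certs/N0` (lemma R-I′ rows) and `Certs/P2R4` (per-interval COVER files) evaluators): `EvalData1…7.lean` (§1–2: constants and the 14 piece matrices — DATA) → `EvalRule.lean` (§3: the rule `Mel`, its pencil forms, the real pencil `MelR` and the block-to-pencil transfer) → `EvalGramB.lean` + `EvalGrams.lean` (§4: `Bcoef ⪰ 0` by a streaming integer Gram certificate, `Acoef ⪰ 0` diagonal, `TT ⪰ 0` Gram) → `EvalBlock01…59.lean` (§5: one file per block, the evaluator identity `eval_j : B0jj.A = den_j • Mel ε_j u_j v_j` against the landed block module, via the LIST identity `B0jj.A_rows = EvalRows.lincomb (psOf …)` — `TurbBounds/EvalRows.lean`) → `Cover01…Cover30.lean` (§6: per cover interval, the interval theorem `interval_i`) → `Evaluator.lean` (§8: **`certificate`**; `cutoff` is in EvalData1 — the full statement of what is and is NOT kernel-checked is in THAT file's header); generic interval lemmas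 in `TurbBounds/IntervalLemma.lean` + `IntervalLemmaR.lean` (in the tree).
-/

set_option linter.style.longLine false
set_option linter.style.setOption false
set_option linter.unusedSimpArgs false
set_option maxRecDepth 100000

namespace Summit.NavierStokesRegularity.TurbBounds.Certs.N1prime.Evaluator

open Literature.Computation.Certificates Matrix

/-! ## 3. The mode rule and its pencil form -/

/-- **The mode rule** `M(ε; u, v) = a0·(PW0 + u·PWu + v·PWv) + s·(PT0 + v·PTv) + Σ_{p≤6} ĝ_p·CE_p − T·ε·TW − (T/ε)·TT`, `a0 = (s−1)/Ra`, `ĝ₀ = −s`, `ĝ_p = φ̂_p`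
(rbsdp SPEC 3.3–3.6 / `RBMode.block_at(s, φ̂)` = `C0 + s·Cs + Σ_p φ̂_p·Cφ_p + T·CT` with `C0 = −X_W/Ra`, `Cs = X_W/Ra ⊕ X_T − [E₀]`, `Cφ_p = [E_p]`, `CT(ε) = −ε(GW0+HW) ⊕ −ε⁻¹(GT0+HT)`,
projected; `X_W = 16u·diag + 8·D1-Gram + v·D0-Gram`, `X_T = 4·diag + v·DT-Gram`). -/
def Mel (ε u v : ℚ) : QMat :=
  a0 • (PW0 + u • PWu + v • PWv) + s • (PT0 + v • PTv) + ghat0 • CE0 + ghat1 • CE1 + ghat2 • CE2 + ghat3 • CE3 + ghat4 • CE4 + ghat5 • CE5 + ghat6 • CE6 + (-(T * ε)) • TW + (-(T / ε)) • TT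

/-- The data-free part of the pencil at Young weight `ε`. -/
def M0 (ε : ℚ) : QMat := a0 • PW0 + s • PT0 + ghat0 • CE0 + ghat1 • CE1 + ghat2 • CE2 + ghat3 • CE3 + ghat4 • CE4 + ghat5 • CE5 + ghat6 • CE6 + (-(T * ε)) • TW + (-(T / ε)) • TT
/-- The coefficient of `u = KINV2`: `a0·PWu`. -/
def Acoef : QMat := a0 • PWu
/-- The coefficient of `v = K2`: `a0·PWv + s·PTv`. -/
def Bcoef : QMat := a0 • PWv + s • PTv

/-- The mode rule is the affine pencil `M0 ε + u • Acoef + v • Bcoef` in the wavenumber data. -/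
theorem Mel_pencil (ε u v : ℚ) : Mel ε u v = M0 ε + u • Acoef + v • Bcoef := by
  ext i j
  simp only [Mel, M0, Acoef, Bcoef, Matrix.add_apply, Matrix.smul_apply, smul_eq_mul]
  ring

/-- The data-free AND `ε`-free part `Mb = a0·PW0 + s·PT0 + Σ_p ĝ_p·CE_p` (the blocks of one K-interval carry DIFFERENT Young weights `ε` in this row — lemma R-I′). -/
def Mb : QMat := a0 • PW0 + s • PT0 + ghat0 • CE0 + ghat1 • CE1 + ghat2 • CE2 + ghat3 • CE3 + ghat4 • CE4 + ghat5 • CE5 + ghat6 • CE6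

/-- Five-term form of the rule: `Mel ε u v = Mb + u • Acoef + v • Bcoef − (Tε) • TW − (T/ε) • TT`. -/
theorem Mel_pencil5 (ε u v : ℚ) : Mel ε u v = Mb + u • Acoef + v • Bcoef + (-(T * ε)) • TW + (-(T / ε)) • TT := by
  ext i j
  simp only [Mel, Mb, Acoef, Bcoef, Matrix.add_apply, Matrix.smul_apply, smul_eq_mul]
  ring

/-! ## 3b. The real pencil (real wavenumber data AND real Young weight) and the transfer of block PSD facts to it -/

/-- The `ε`-dependent, data-free part over `ℝ`: `Mb − (Tε)·TW − (T/ε)·TT` for a REAL Young weight `ε` (lemma R-I′ produces Young weights that are convex combinations of the blocks' rational ones). -/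
noncomputable def MbR (ε : ℝ) : Matrix (Fin 62) (Fin 62) ℝ :=
  Mb.map (Rat.cast : ℚ → ℝ) + (-((T : ℝ) * ε)) • TW.map (Rat.cast : ℚ → ℝ) + (-((T : ℝ) / ε)) • TT.map (Rat.cast : ℚ → ℝ)

/-- The mode rule over `ℝ` with REAL wavenumber data `(u, v)` (needed at `(1/K, K)` for irrational `K`) and real Young weight `ε`. -/
noncomputable def MelR (ε u v : ℝ) : Matrix (Fin 62) (Fin 62) ℝ :=
  MbR ε + u • Acoef.map (Rat.cast : ℚ → ℝ) + v • Bcoef.map (Rat.cast : ℚ → ℝ)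

/-- Five-term form of the real rule. -/
theorem MelR_eq5 (ε u v : ℝ) : MelR ε u v = Mb.map (Rat.cast : ℚ → ℝ) + u • Acoef.map (Rat.cast : ℚ → ℝ) + v • Bcoef.map (Rat.cast : ℚ → ℝ)
    + (-((T : ℝ) * ε)) • TW.map (Rat.cast : ℚ → ℝ) + (-((T : ℝ) / ε)) • TT.map (Rat.cast : ℚ → ℝ) := by
  ext i j
  simp only [MelR, MbR, Matrix.add_apply, Matrix.smul_apply, smul_eq_mul]
  ring

/-- At rational data and rational Young weight the real rule is the cast of the rational rule. -/
theorem MelR_eq_map (ε u v : ℚ) : MelR (ε : ℝ) (u : ℝ) (v : ℝ) = (Mel ε u v).map (Rat.cast : ℚ → ℝ) := by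
  ext i j
  simp only [MelR, MbR, Mel_pencil5, Matrix.add_apply, Matrix.smul_apply, Matrix.map_apply, smul_eq_mul, Rat.cast_add,
    Rat.cast_mul, Rat.cast_neg, Rat.cast_div]
  ring

/-- Transfer: if a kernel-certified PSD block `A` equals `den • Mel ε u v` with `den > 0`, the real rule is PSD at `(ε, u, v)`. -/
theorem MelR_posSemidef_of_eval {A : QMat} {den ε u v : ℚ} (hden : 0 < den) (h : A = den • Mel ε u v)
    (hA : (A.map (Rat.cast : ℚ → ℝ)).PosSemidef) {ε' u' v' : ℝ} (he : ε' = (ε : ℝ)) (hu : u' = (u : ℝ)) (hv : v' = (v : ℝ)) :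
    (MelR ε' u' v').PosSemidef := by
  subst he; subst hu; subst hv
  have hcast : A.map (Rat.cast : ℚ → ℝ) = (den : ℝ) • MelR (ε : ℝ) (u : ℝ) (v : ℝ) := by
    rw [MelR_eq_map, h]
    ext i j
    simp only [Matrix.map_apply, Matrix.smul_apply, smul_eq_mul, Rat.cast_mul]
  have hden' : (0 : ℝ) < (den : ℝ) := by exact_mod_cast hden
  have hinv : MelR (ε : ℝ) (u : ℝ) (v : ℝ) = (den : ℝ)⁻¹ • A.map (Rat.cast : ℚ → ℝ) := by
    rw [hcast, smul_smul, inv_mul_cancel₀ hden'.ne', one_smul]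
  rw [hinv]
  exact hA.smul (inv_nonneg.mpr hden'.le)

/-! ## 3c. Fast evaluator identities (v2.2): `den • Mel ε u v` ASSEMBLED as row lists by `TurbBounds/EvalRows.lean` (one pass per piece) -/

/-- The 14 (coefficient, piece rows) pairs of `den • Mel ε u v` in the order of `Mel_pencil5`'s pieces (for `EvalRows.lincomb`). -/
def psOf (den ε u v : ℚ) : List (ℚ × List (List ℚ)) :=
  [(den * a0, PW0_rows), (den * (a0 * u), PWu_rows), (den * (a0 * v), PWv_rows), (den * s, PT0_rows), (den * (s * v), PTv_rows), (den * ghat0, CE0_rows), (den * ghat1, CE1_rows), (den * ghat2, CE2_rows), (den * ghat3, CE3_rows), (den * ghat4, CE4_rows), (den * ghat5, CE5_rows), (den * ghat6, CE6_rows), (den * (-(T * ε)), TW_rows), (den * (-(T / ε)), TT_rows)]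

/-- The assembled linear combination IS `den • Mel ε u v` (module algebra over the 14 opaque pieces). -/
theorem combSum_psOf (den ε u v : ℚ) : EvalRows.combSum 62 (psOf den ε u v) = den • Mel ε u v := by
  simp only [psOf, EvalRows.combSum_cons, EvalRows.combSum_nil]
  rw [show matrixOfRows 62 62 PW0_rows = PW0 from rfl, show matrixOfRows 62 62 PWu_rows = PWu from rfl, show matrixOfRows 62 62 PWv_rows = PWv from rfl, show matrixOfRows 62 62 PT0_rows = PT0 from rfl, show matrixOfRows 62 62 PTv_rows = PTv from rfl, show matrixOfRows 62 62 CE0_rows = CE0 from rfl, show matrixOfRows 62 62 CE1_rows = CE1 from rfl, show matrixOfRows 62 62 CE2_rows = CE2 from rfl, show matrixOfRows 62 62 CE3_rows = CE3 from rfl, show matrixOfRows 62 62 CE4_rows = CE4 from rfl, show matrixOfRows 62 62 CE5_rows = CE5 from rfl, show matrixOfRows 62 62 CE6_rows = CE6 from rfl, show matrixOfRows 62 62 TW_rows = TW from rfl, show matrixOfRows 62 62 TT_rows = TT from rfl]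
  ext i j
  simp only [Mel, Matrix.add_apply, Matrix.smul_apply, Matrix.zero_apply, smul_eq_mul]
  ring

/-- From the LIST identity `A_rows = lincomb (psOf …)` (kernel `decide`, linear cost) to the evaluator identity. -/
theorem eval_of_rows {A_rows : List (List ℚ)} {den ε u v : ℚ} (h : A_rows = EvalRows.lincomb 62 (psOf den ε u v)) :
    matrixOfRows 62 62 A_rows = den • Mel ε u v := by
  rw [h, EvalRows.matrixOfRows_lincomb, combSum_psOf]

end Summit.NavierStokesRegularity.TurbBounds.Certs.N1prime.Evaluator
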